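import Summits.QuantumFields.YangMills.Theorems.BalabanUVNodesN21LowCentreEndAtSUNBlockChartPackageCoercive
import Mathlib.Analysis.Real.Pi.Bounds

/-!
# N21 (NE7c) · REGIME VACUITY OF THE n21-w1 LINEAGE's (M1) ENDS AS TYPED — referee pub-ymgap-dag-ref-O g16's kernel probe of the READ #422 SECOND-GAP
# (INBOX l.42553 ∕ l.43223) LANDED AS A TREE CERTIFICATE by the N21 lane owner (the desk READS and never files; the w-seats are closed)

R134 seat `pub-ymgap-dag-n21-d` (g17, lane owner N21), strategy s2; key K3⁸ `SpineGivenEndpointR13SepCoPHV` = stmt-QuantumFields-27366, `--kind proof --supports 27366 --as helper`;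
COUNT-NEUTRAL.  Theorems only (0 `def`, 0 `sorry`, no `instance`, no `notation`).  CREDIT: statements (A)–(D) and their proofs are referee ref-O g16's probe
`pub-ymgap-dag-ref-O/READS/n21-w1-p648180-probe-g16.lean` (sha16 c1fae79c37facf26; farm rc 0, axioms std, 2026-08-28T21:30Z) VERBATIM up to names, namespace and docstrings;
the finding is ref-O g15's READ #422 SECOND-GAP (I.42553) on dag-n21-w1 g5's file 36 p648180, made kernel-exact by ref-O g16 (I.43223).  Landed here so that the chair ∕ director-ym ∕
plan can rule on the (M1) END's STATEMENT SHAPE against a tree fact (dag-lead g19 GATE v1.109 row N21, l.43532).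

WHAT IS PROVED ([folklore] real analysis + measure bookkeeping; NO estimate of Bałaban's):
* (A) `sq_div_ten_le_neg_two_log_sinc` — `S²∕10 ≤ −2 log sinc S` on `(0, π)`;
* (B) `clause_lower_bound` — file 20's clause `hclause` (+ `hW`, `|b| ≥ 1`, `N ≥ 2`, `d ≥ 1`, `M ≥ 1`) gives `1.92·10⁵·S²L² ≤ γ₀(θ(1−ρ−σ))²`;
* (C) ★★ `slotAntiConcentration_vacuous_of_binders` — with `γ₀ < 1.92·10⁵` the shell `{θ(1−ρ) ≤ U < θ}` misses `closedBall 0 S` (`hUL`, `hUc`), so every `SlotAntiConcentration`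
  conclusion about a measure with density supported in `K₀ ∩ closedBall 0 S` holds for EVERY constant `D` (`measure_mono_null`);
* (D) ★★ `cutChartLawShape_slotAntiConcentration_of_support_binders` — file 20's ★ conclusion (`…LowCentreEndAtSUNBlockChartPackageCoercive` p621358 `cutChartLawAC_…_of_ineq17` :123–:180, conclusion
  :170–:176; verbatim shape in files 30 ∕ 31 ∕ 34 ∕ 35 ∕ 36) is an instance of (C): at `γ₀ < 1.92·10⁵` it follows from eleven support∕clause binders alone.

SCOPE: the CUT chart law's (M1) ends (file 20 :170–:176; editions 30 ∕ 31 ∕ 34 ∕ 35 with the same density support `(K₀ ∩ closedBall 0 S).indicator …`, statistic `U`, rows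
`hUL ∕ hUc ∕ hclause`); the CHART law :113–:115 is NOT covered (ref-O g17 I.≈43670 (b)).  Statements (A)–(D) are the probe's VERBATIM; proofs verbatim except that each
`first | … | …` fallback is resolved to the branch the kernel executes (lint) — the re-shaping is this lane's, the finding ref-O's.
MEANING (honest; ref-O's words made the lane's): nothing in files 20 ∕ 30 ∕ 31 ∕ 34–36 is wrong and no verdict changes (READ #422 PASS ∕ NOT-A-DISCHARGE stands); but in the
programme's regime the cut-chart-law (M1) ENDS AS TYPED are consequences of their own binders — the (M1) content N21 owes at print's FIXED letter must live in a statement whose clause does not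
push `θ` above `σθ + L·S`, or in a consumer that never needs the fixed-letter shell mass.  The lane's reading of the alternative (LANDED-1 line I.≈43641): the second branch is the
gapped pin of record (`…N21GappedPairRoadK3V6KnitZeta` p658766: N21's face with dial rows only), and at the v6 record pin `…N21RecordPinShellSplitExtremal` p674620 shows the face for
any N19′-useful split IS a class-summed fixed-letter (M1) law — which no file types non-vacuously today.

HONEST FRAMING (binding).  A vacuity certificate of a HYPOTHESIS SHAPE; nothing of Bałaban's asserted; NE7c ∕ (M1) NOT PRINTED ∕ NOT proved; N21 NOT discharged; K3⁸ NOT claimed;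
skeleton v6 untouched; counts UNMOVED (typed 28∕28 · discharged 6∕28, display 6∕27); never a count claim; this lane never rules on the w-lineage's statement shape — the chair ∕
director do.  Standard axioms only.  One finite four-torus programme at fixed `ε` — NOT ℝ⁴, NOT OS, NOT a mass gap, NOT the Clay problem.
-/

set_option autoImplicit false

noncomputable section

open MeasureTheory Set Function Finset Metric
open scoped ENNReal BigOperators Matrix

namespace Summit.QuantumFields.YangMills.Theorems.N21LowCentreEndRegimeVacuity

open Literature.MathematicalPhysics.QuantumFieldTheory.Balaban1983to89
open Literature.MathematicalPhysics.QuantumFieldTheory.Balaban1983to89.T4Continuum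
open Literature.MathematicalPhysics.QuantumFieldTheory.Balaban1983to89.Node00 hiding dimSU
open Literature.MathematicalPhysics.QuantumFieldTheory.Balaban1983to89.T4ShellMeasure (SlotAntiConcentration)
open Summit.QuantumFields.BalabanUV.T4Continuum
open Summit.QuantumFields.BalabanUV.T4Continuum.ShellMeasureExpChartSUN (SUN ChartSU BlockChartSU dimSU dimSU_eq)

/-- ★ **(A)** elementary: `S²∕10 ≤ −2 log (sinc S)` on `(0, π)` (Mathlib `Real.sin_le`, `Real.cos_le_one_sub_mul_cos_sq`, `Real.log_le_sub_one_of_pos`, `Real.pi_lt_d2`;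
ref-O g16 (A); the desk card's sharper hand constant `S²∕6` is not needed). [folklore] -/
theorem sq_div_ten_le_neg_two_log_sinc {S : ℝ} (hS : 0 < S) (hSπ : S < Real.pi) :
    S ^ 2 / 10 ≤ -2 * Real.log (Real.sinc S) := by
  have hsin : 0 < Real.sin S := Real.sin_pos_of_pos_of_lt_pi hS hSπ
  have hsinc_pos : 0 < Real.sinc S := by
    rw [Real.sinc_of_ne_zero hS.ne']; positivity
  have h2 : Real.sin S = 2 * Real.sin (S / 2) * Real.cos (S / 2) := by
    have := Real.sin_two_mul (S / 2)
    rw [show 2 * (S / 2) = S by ring] at this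
    exact this
  have hs : Real.sin (S / 2) ≤ S / 2 := Real.sin_le (by linarith)
  have hc : Real.cos (S / 2) ≤ 1 - 2 / Real.pi ^ 2 * (S / 2) ^ 2 :=
    Real.cos_le_one_sub_mul_cos_sq (by rw [abs_of_pos (by linarith)]; linarith [Real.pi_pos])
  have hc0 : 0 ≤ Real.cos (S / 2) :=
    Real.cos_nonneg_of_mem_Icc ⟨by linarith [Real.pi_pos], by linarith⟩
  have hprod := mul_le_mul hs hc hc0 (by linarith)
  have hpi2 : 0 < Real.pi ^ 2 := by positivity
  have hsinS : Real.sin S ≤ S * (1 - S ^ 2 / (2 * Real.pi ^ 2)) := by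
    rw [h2]
    have : 2 * (Real.sin (S / 2) * Real.cos (S / 2)) ≤ 2 * (S / 2 * (1 - 2 / Real.pi ^ 2 * (S / 2) ^ 2)) :=
      mul_le_mul_of_nonneg_left hprod (by norm_num)
    have e : 2 * (S / 2 * (1 - 2 / Real.pi ^ 2 * (S / 2) ^ 2)) = S * (1 - S ^ 2 / (2 * Real.pi ^ 2)) := by
      field_simp
    linarith [this, e]
  have hsinc_le : Real.sinc S ≤ 1 - S ^ 2 / (2 * Real.pi ^ 2) := by
    rw [Real.sinc_of_ne_zero hS.ne', div_le_iff₀ hS]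
    linarith [hsinS]
  have hlog : Real.log (Real.sinc S) ≤ Real.sinc S - 1 := Real.log_le_sub_one_of_pos hsinc_pos
  have hpi : Real.pi ^ 2 ≤ 10 := by nlinarith [Real.pi_lt_d2, Real.pi_pos]
  have hfrac : S ^ 2 / 20 ≤ S ^ 2 / (2 * Real.pi ^ 2) :=
    div_le_div_of_nonneg_left (by positivity) (by positivity) (by linarith)
  linarith

/-- ★ **(B)** the numeric consequence of file 20's clause `hclause` (with `hW`, `hb`, `hN`, `hd`, `hM`, `S ∈ (0, π)`): `1.92·10⁵ · S²L² ≤ γ₀·(θ(1−ρ−σ))²` — the bracket is at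
least its sinc term `≥ |b|·N²·S²∕10 ≥ 4·S²∕10`, `d ≥ 1`, `(100M)^{d+1} ≥ 10⁴`, `dimSU N ≥ 3` (ref-O g16 (B)). [folklore] -/
theorem clause_lower_bound {N : ℕ} [NeZero N] {P : Params} {j : ℕ} {d : ℕ}
    (hN : 2 ≤ N) (b : Finset (PBond P j)) (hb : b.Nonempty)
    {S : ℝ} (hS : 0 < S) (hSπ : S < Real.pi)
    {θ ρ σ L γ₀ B₃ M₀ A₀ p₀g Rk WV : ℝ} (M : ℕ)
    (hd : 1 ≤ d) (hM : 0 < M)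
    (hW : 0 ≤ 3 * B₃ * M₀ * A₀ ^ 2 * p₀g ^ 2 * Real.exp (-Rk) * (100 * (M : ℝ)) ^ 4 + WV)
    (hclause : 16 * (3 * B₃ * M₀ * A₀ ^ 2 * p₀g ^ 2 * Real.exp (-Rk) * (100 * (M : ℝ)) ^ 4 +
        (WV + b.card * ((N * N : ℕ) * (-2 * Real.log (Real.sinc S))))) * d
      * (100 * (M : ℝ)) ^ (d + 1) * (dimSU N * L ^ 2) ≤ γ₀ * (θ * (1 - ρ - σ)) ^ 2) :
    192000 * (S ^ 2 * L ^ 2) ≤ γ₀ * (θ * (1 - ρ - σ)) ^ 2 := by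
  have hlogS := sq_div_ten_le_neg_two_log_sinc hS hSπ
  have hcard : (1 : ℝ) ≤ b.card := by exact_mod_cast hb.card_pos
  have hNN : (4 : ℝ) ≤ ((N * N : ℕ) : ℝ) := by
    have : 4 ≤ N * N := by nlinarith
    exact_mod_cast this
  have hdim : (3 : ℝ) ≤ (dimSU N : ℝ) := by
    have : 3 ≤ dimSU N := by
      rw [dimSU_eq]
      have : 4 ≤ N ^ 2 := by nlinarith
      omega
    exact_mod_cast this
  have hdR : (1 : ℝ) ≤ d := by exact_mod_cast hd
  have hMR : (1 : ℝ) ≤ M := by exact_mod_cast hM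
  have hpow : (10000 : ℝ) ≤ (100 * (M : ℝ)) ^ (d + 1) := by
    have h1 : (100 : ℝ) ^ 2 ≤ (100 : ℝ) ^ (d + 1) :=
      pow_le_pow_right₀ (by norm_num) (by omega)
    have h2 : (100 : ℝ) ^ (d + 1) ≤ (100 * (M : ℝ)) ^ (d + 1) :=
      pow_le_pow_left₀ (by norm_num) (by linarith) _
    nlinarith [h1, h2]
  -- the bracket is at least the sinc term, which is at least `4 · S²∕10`
  have hT : (2 / 5) * S ^ 2 ≤ b.card * ((N * N : ℕ) * (-2 * Real.log (Real.sinc S))) := by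
    have h0 : 0 ≤ -2 * Real.log (Real.sinc S) := le_trans (by positivity) hlogS
    have hA : 4 * (S ^ 2 / 10) ≤ ((N * N : ℕ) : ℝ) * (-2 * Real.log (Real.sinc S)) :=
      mul_le_mul hNN hlogS (by positivity) (by linarith)
    have hB : 1 * (((N * N : ℕ) : ℝ) * (-2 * Real.log (Real.sinc S))) ≤
        b.card * (((N * N : ℕ) : ℝ) * (-2 * Real.log (Real.sinc S))) :=
      mul_le_mul_of_nonneg_right hcard (by positivity)
    nlinarith [hA, hB]
  have hbr : (2 / 5) * S ^ 2 ≤ 3 * B₃ * M₀ * A₀ ^ 2 * p₀g ^ 2 * Real.exp (-Rk) * (100 * (M : ℝ)) ^ 4 +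
      (WV + b.card * ((N * N : ℕ) * (-2 * Real.log (Real.sinc S)))) := by linarith
  set Br := 3 * B₃ * M₀ * A₀ ^ 2 * p₀g ^ 2 * Real.exp (-Rk) * (100 * (M : ℝ)) ^ 4 +
      (WV + b.card * ((N * N : ℕ) * (-2 * Real.log (Real.sinc S)))) with hBr
  set Pw := (100 * (M : ℝ)) ^ (d + 1) with hPw
  have hBr0 : 0 ≤ Br := le_trans (by positivity) hbr
  have hL2 : 0 ≤ L ^ 2 := sq_nonneg L
  -- chain: 16·Br·d·Pw·(dimSU·L²) ≥ 16·(2∕5 S²)·1·10⁴·(3 L²) = 192000 S² L²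
  have s1 : 16 * ((2 / 5) * S ^ 2) ≤ 16 * Br := by linarith
  have s2 : 16 * ((2 / 5) * S ^ 2) * 1 ≤ 16 * Br * d :=
    mul_le_mul s1 hdR (by norm_num) (by linarith)
  have s3 : 16 * ((2 / 5) * S ^ 2) * 1 * 10000 ≤ 16 * Br * d * Pw :=
    mul_le_mul s2 hpow (by norm_num) (by positivity)
  have s4 : 3 * L ^ 2 ≤ (dimSU N : ℝ) * L ^ 2 := mul_le_mul_of_nonneg_right hdim hL2
  have s5 : 16 * ((2 / 5) * S ^ 2) * 1 * 10000 * (3 * L ^ 2) ≤ 16 * Br * d * Pw * ((dimSU N : ℝ) * L ^ 2) :=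
    mul_le_mul s3 s4 (by positivity) (by positivity)
  have e : 16 * ((2 / 5) * S ^ 2) * 1 * 10000 * (3 * L ^ 2) = 192000 * (S ^ 2 * L ^ 2) := by ring
  linarith [s5, e, hclause]

/-- ★★ **(C) THE SECOND-GAP OF READ #422, IN THE KERNEL (ref-O g16 (C)).**  Under file 20's binders `hUL` (U is `L`-Lipschitz), `hUc` (`U 0 ≤ σθ`), the clause `hclause` with
`hW`, and `|b| ≥ 1`, `N ≥ 2`, `d ≥ 1`, `M ≥ 1`, `S ∈ (0, π)`, `0 < θ`, `ρ + σ ≤ 1`, `0 < L`: whenever `0 < γ₀ < 1.92·10⁵` the clause forces `L·S < θ(1−ρ−σ)`, so on `closedBall 0 S`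
one has `U ≤ σθ + L·S < θ(1−ρ)` — the shell `{θ(1−ρ) ≤ U < θ}` MISSES the ball; hence EVERY `SlotAntiConcentration` statement about a measure carried by a density supported in
`K₀ ∩ closedBall 0 S` (restricted to any set `T`) holds for EVERY constant `D`, by `measure_mono_null` — with no use of the (1.7)∕(1.8)∕(1.9) rows, the analytic letter, `hQ`,
`hRT` or `henv`.  In the programme's regime (flat background `γ₀ = 1` of files 34–36; any O(1) coercivity constant) the CUT-CHART-LAW (M1) ENDS of the n21-w1 lineage AS TYPED
(file 20 :170–:176 and the editions 30 ∕ 31 ∕ 34 ∕ 35 with the same density support and statistic) thus carry no content beyond their binders; their A6 witnesses (files 13 ∕ 16 ∕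
36) inhabit degenerate instances only.  NOT covered: the CHART law of file 20 :113–:115 (`chartWeightSU · R ∘ expFibreChartSU`), which would need its own derivation. [bookkeeping] -/
theorem slotAntiConcentration_vacuous_of_binders {N : ℕ} [NeZero N] {P : Params} {j : ℕ} {d : ℕ}
    (hN : 2 ≤ N) (b : Finset (PBond P j)) (hb : b.Nonempty)
    {S : ℝ} (hS : 0 < S) (hSπ : S < Real.pi)
    (K₀ : Set (BlockChartSU N b)) {U : BlockChartSU N b → ℝ}
    {θ ρ σ L γ₀ B₃ M₀ A₀ p₀g Rk WV : ℝ} (M : ℕ)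
    (hθ : 0 < θ) (hρσ : ρ + σ ≤ 1) (hL : 0 < L) (hd : 1 ≤ d) (hM : 0 < M) (hγ₀ : 0 < γ₀)
    (hγ₀' : γ₀ < 192000)
    (hW : 0 ≤ 3 * B₃ * M₀ * A₀ ^ 2 * p₀g ^ 2 * Real.exp (-Rk) * (100 * (M : ℝ)) ^ 4 + WV)
    (hUL : ∀ z z' : BlockChartSU N b, U z - U z' ≤ L * ‖z - z'‖)
    (hUc : U 0 ≤ σ * θ)
    (hclause : 16 * (3 * B₃ * M₀ * A₀ ^ 2 * p₀g ^ 2 * Real.exp (-Rk) * (100 * (M : ℝ)) ^ 4 +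
        (WV + b.card * ((N * N : ℕ) * (-2 * Real.log (Real.sinc S))))) * d
      * (100 * (M : ℝ)) ^ (d + 1) * (dimSU N * L ^ 2) ≤ γ₀ * (θ * (1 - ρ - σ)) ^ 2) :
    ∀ (g : BlockChartSU N b → ℝ≥0∞) (T : Set (BlockChartSU N b)) (D : ℝ),
      SlotAntiConcentration
        (((volume : Measure (BlockChartSU N b)).withDensity fun z =>
            (K₀ ∩ closedBall (0 : BlockChartSU N b) S).indicator g z).restrict T) U θ ρ D := by
  intro g T D
  -- (i) the clause forces `L S < θ(1−ρ−σ)`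
  have hnum := clause_lower_bound hN b hb hS hSπ (θ := θ) (ρ := ρ) (σ := σ) M hd hM hW hclause
  have hX0 : 0 ≤ θ * (1 - ρ - σ) := mul_nonneg hθ.le (by linarith)
  have hLS : L * S < θ * (1 - ρ - σ) := by
    by_contra hcon
    rw [not_lt] at hcon
    have hsq : (θ * (1 - ρ - σ)) ^ 2 ≤ (L * S) ^ 2 := pow_le_pow_left₀ hX0 hcon 2
    have hpos : 0 < S ^ 2 * L ^ 2 := by positivity
    have : γ₀ * (θ * (1 - ρ - σ)) ^ 2 ≤ γ₀ * (L * S) ^ 2 := mul_le_mul_of_nonneg_left hsq hγ₀.le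
    nlinarith [hnum, this, hpos, hγ₀']
  -- (ii) the shell lies outside the closed ball
  have hsub : {x | θ * (1 - ρ) ≤ U x ∧ U x < θ} ⊆ (closedBall (0 : BlockChartSU N b) S)ᶜ := by
    intro x hx hxS
    rw [mem_closedBall, dist_zero_right] at hxS
    have h1 := hUL x 0
    rw [sub_zero] at h1
    have hnorm : L * ‖x‖ ≤ L * S := mul_le_mul_of_nonneg_left hxS hL.le
    have : U x ≤ σ * θ + L * S := by linarith [h1, hUc, hnorm]
    have hshell := hx.1
    nlinarith [this, hshell, hLS]
  -- (iii) the density vanishes off the ball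
  have hnull : ((volume : Measure (BlockChartSU N b)).withDensity fun z =>
      (K₀ ∩ closedBall (0 : BlockChartSU N b) S).indicator g z) (closedBall (0 : BlockChartSU N b) S)ᶜ = 0 := by
    rw [withDensity_apply _ measurableSet_closedBall.compl]
    have hzero : ∀ z ∈ (closedBall (0 : BlockChartSU N b) S)ᶜ,
        (K₀ ∩ closedBall (0 : BlockChartSU N b) S).indicator g z = 0 := by
      intro z hz
      have hmem : z ∉ K₀ ∩ closedBall (0 : BlockChartSU N b) S := fun h => hz h.2
      exact Set.indicator_of_notMem hmem g
    calc ∫⁻ z in (closedBall (0 : BlockChartSU N b) S)ᶜ,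
          (K₀ ∩ closedBall (0 : BlockChartSU N b) S).indicator g z ∂volume
        = ∫⁻ z in (closedBall (0 : BlockChartSU N b) S)ᶜ, (0 : ℝ≥0∞) ∂volume := by
          refine setLIntegral_congr_fun measurableSet_closedBall.compl ?_
          exact hzero
      _ = 0 := lintegral_zero
  -- (iv) conclude
  have hshell0 : (((volume : Measure (BlockChartSU N b)).withDensity fun z =>
      (K₀ ∩ closedBall (0 : BlockChartSU N b) S).indicator g z).restrict T)
        {x | θ * (1 - ρ) ≤ U x ∧ U x < θ} = 0 := by
    refine le_antisymm ?_ zero_le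
    calc (((volume : Measure (BlockChartSU N b)).withDensity fun z =>
          (K₀ ∩ closedBall (0 : BlockChartSU N b) S).indicator g z).restrict T)
            {x | θ * (1 - ρ) ≤ U x ∧ U x < θ}
        ≤ ((volume : Measure (BlockChartSU N b)).withDensity fun z =>
          (K₀ ∩ closedBall (0 : BlockChartSU N b) S).indicator g z) {x | θ * (1 - ρ) ≤ U x ∧ U x < θ} :=
          Measure.restrict_le_self _
      _ = 0 := measure_mono_null hsub hnull
  unfold SlotAntiConcentration
  rw [hshell0]
  exact zero_le

/-- ★★ **(D) THE INSTANCE OF RECORD — FILE 20's CONCLUSION SHAPE.**  File 20's ★ `cutChartLawAC_of_sect1Letters_analyticLocal_of_ineq17` (p621358 :123–:180, conclusion :170–:176; binders shared with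
`chartAC_…` :64 ∕ `chartPackage_…` :181 and verbatim in files 30 ∕ 31 ∕ 34 ∕ 35 ∕ 36 of the n21-w1 lineage) concludes `SlotAntiConcentration` for the CUT CHART LAW — density
`(K₀ ∩ closedBall 0 S).indicator (ofReal (exp (−(A + Σ_i (−log det duhT) − |b|·log κ_SU))))`, restricted to `{U < θ} ∩ C`, constant `3(|b|·dimSU + 1)(1+Q)∕(κ₀(1−ρ))` — which is
the `g := …`, `T := {U < θ} ∩ C` case of (C): at `γ₀ < 1.92·10⁵` that conclusion follows from the ELEVEN support∕clause binders `hN hb hS hSπ hθ hρσ hL hd hM hW hUL hUc hclause`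
alone, WITHOUT the (1.7)∕(1.8)∕(1.9) rows, the analytic letter, `hQ`, `hRT`, `henv` or the other binders of file 20.  (REGIME VACUITY of the (M1) END as typed; ref-O g16 (D).)
[bookkeeping] -/
theorem cutChartLawShape_slotAntiConcentration_of_support_binders {N : ℕ} [NeZero N] {P : Params} {j : ℕ} {d : ℕ}
    (hN : 2 ≤ N) (b : Finset (PBond P j)) (hb : b.Nonempty)
    {S : ℝ} (hS : 0 < S) (hSπ : S < Real.pi)
    (K₀ : Set (BlockChartSU N b)) (A : BlockChartSU N b → ℝ) {U : BlockChartSU N b → ℝ}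
    {C : Set (BlockChartSU N b)}
    {θ ρ σ κ₀ Q L γ₀ B₃ M₀ A₀ p₀g Rk WV : ℝ} (M : ℕ)
    (hθ : 0 < θ) (hρσ : ρ + σ ≤ 1) (hL : 0 < L) (hd : 1 ≤ d) (hM : 0 < M) (hγ₀ : 0 < γ₀)
    (hγ₀' : γ₀ < 192000)
    (hW : 0 ≤ 3 * B₃ * M₀ * A₀ ^ 2 * p₀g ^ 2 * Real.exp (-Rk) * (100 * (M : ℝ)) ^ 4 + WV)
    (hUL : ∀ z z' : BlockChartSU N b, U z - U z' ≤ L * ‖z - z'‖)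
    (hUc : U 0 ≤ σ * θ)
    (hclause : 16 * (3 * B₃ * M₀ * A₀ ^ 2 * p₀g ^ 2 * Real.exp (-Rk) * (100 * (M : ℝ)) ^ 4 +
        (WV + b.card * ((N * N : ℕ) * (-2 * Real.log (Real.sinc S))))) * d
      * (100 * (M : ℝ)) ^ (d + 1) * (dimSU N * L ^ 2) ≤ γ₀ * (θ * (1 - ρ - σ)) ^ 2) :
    SlotAntiConcentration
      (((volume : Measure (BlockChartSU N b)).withDensity fun z => (K₀ ∩ closedBall (0 : BlockChartSU N b) S).indicator
        (fun w => ENNReal.ofReal (Real.exp (-(A w +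
          (∑ i, -Real.log (LinearMap.det (Summit.QuantumFields.BalabanUV.T4Continuum.ShellMeasureExpDuhamelSUN.duhT (w i) : ChartSU N →ₗ[ℝ] ChartSU N))) -
            b.card * Real.log (Summit.QuantumFields.BalabanUV.T4Continuum.ShellMeasureExpHaarAreaSUN.kappaSU N).toReal)))) z).restrict ({z | U z < θ} ∩ C))
      U θ ρ (3 * ((b.card : ℝ) * dimSU N + 1) * (1 + Q) / (κ₀ * (1 - ρ))) :=
  slotAntiConcentration_vacuous_of_binders hN b hb hS hSπ K₀ M hθ hρσ hL hd hM hγ₀ hγ₀' hW hUL hUc hclause _ _ _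

end Summit.QuantumFields.YangMills.Theorems.N21LowCentreEndRegimeVacuity

end
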